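import Literature.AnabelianGeometry.SemiGraphs.OneVertexWitnessChart
import Literature.AnabelianGeometry.SemiGraphs.TemperedFunctorialitySlimProofs
import Mathlib.NumberTheory.Padics.RingHoms
import HarnessLib

/-!
# [SemiAnbd] Prop. 3.6 (iv), second clause, as the BARE residual `VerticialHomRelativelyTempSlim 𝒢 c`: the
# universal closure is false — the one-vertex witness over the ABELIAN profinite group `ℤ₂` (FACT-LIST F-1700)

Mochizuki, *Semi-graphs of anabelioids*, Publ. RIMS **42** (2006) 221–322, §3, Proposition 3.6 (iv) p. 39:
"the resulting homomorphism `π₁^temp(ℋ) → π₁^temp(𝒢)` is relatively temp-slim" and Definition 3.4 (ii) p. 36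
"relatively temp-slim: for every open subgroup `H ⊆ Π₁`, the centralizer `Z_{Π₂}(Im(H))` is trivial"
[cite: MochizukiSemiAnbd2006, Prop 3.6(iv) p.39].

PROOF-ONLY companion (no definitions, no instances) of `TemperedFunctorialitySlimProofs.lean` (seat
abc-iut-L3-t6: the residual named fact `VerticialHomRelativelyTempSlim 𝒢 c` — "every vertex carries a
verticial homomorphism `Π_v → π₁^temp(𝒢)` that is relatively temp-slim"); cell abc-iut, block F, seat
abc-iut-f-045 (gen 4).  FACT-LIST row **F-1700** (R7 TYPE-audit abc-iut-w5-d088: «no EXACT witness of the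
universal closure»; closer of record `verticialHomRelativelyTempSlim_holds (h𝒢 : 𝒢.Prop36Hypotheses) (c)`,
`TemperedVerticialNamedFactsProofs.lean`).  The decl's own docstring says the BARE predicate is not a
theorem; this file supplies the kernel object: over an ABELIAN tempered fundamental group no homomorphism
whatsoever is relatively temp-slim (every centraliser is the whole group), and the tree's one-vertex witness
`OneVertex.graph P` with its EXPLICIT chart `OneVertex.chart L` (`π₁^temp = P` on the nose, abc-iut-L3-t2
`OneVertexWitnessChart.lean`) exists for every profinite `P` with a level family — in particular for
`P = ℤ₂` (written multiplicatively), whose level family `N_n = 2ⁿℤ₂ = ker (ℤ₂ → ℤ/2ⁿ)` is built inside the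
proof from Mathlib's `PadicInt.toZModPow` (open: the closed ball of radius `2⁻ⁿ` in the ultrametric `ℤ₂`;
index `2ⁿ`; a basis of neighbourhoods of `0`).  Verticial slimness / `Prop36Hypotheses` (the closer's binder)
is exactly what excludes such `P`.
* `not_forall_verticialHomRelativelyTempSlim` — the universal closure of F-1700 (universe `0`) is FALSE.
So the row is admissible AT THE NAMED INSTANCE ONLY (R5: `verticialHomRelativelyTempSlim_holds` under
`Prop36Hypotheses`) — untouched.  Refuted-closure ≠ refuted-paper (print's `𝒢` is as in Prop. 3.6: totally
elevated, verticially slim); a FACT row is an assumption label, not an endorsement; nothing here bears on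
[IUTchIII] Cor. 3.12.
-/

noncomputable section

namespace Literature.AnabelianGeometry.SemiGraphs.ProfiniteSemiGraph

open Topology

/-- FACT-LIST **F-1700**: the universal closure of `VerticialHomRelativelyTempSlim` (universe `0`) is FALSE:
for the one-vertex witness `OneVertex.graph ℤ₂` with the explicit chart `π₁^temp = ℤ₂` (level family
`2ⁿℤ₂`), a relatively temp-slim `ψ : ℤ₂ → ℤ₂` would have `Z_{ℤ₂}(ψ(ℤ₂)) = 1`, but `ℤ₂` is abelian and
non-trivial.  Instance of record (untouched): `verticialHomRelativelyTempSlim_holds (h𝒢 : 𝒢.Prop36Hypotheses)`.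
[cite: MochizukiSemiAnbd2006, Prop 3.6(iv) p.39] -/
theorem not_forall_verticialHomRelativelyTempSlim :
    ¬ ∀ (𝒢 : ProfiniteSemiGraph.{0}) (c : TemperedPiChart 𝒢), VerticialHomRelativelyTempSlim 𝒢 c := by
  intro h
  -- the subgroups `N_n = 2ⁿ ℤ₂ = ker (ℤ₂ → ℤ/2ⁿ)` of `P = ℤ₂` (written multiplicatively)
  have hsurj : ∀ n : ℕ, Function.Surjective (PadicInt.toZModPow (p := 2) n) := fun n =>
    ZMod.ringHom_surjective _
  have hmem : ∀ (n : ℕ) (x : Multiplicative ℤ_[2]),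
      x ∈ (PadicInt.toZModPow (p := 2) n).toAddMonoidHom.ker.toSubgroup ↔
        ‖Multiplicative.toAdd x‖ ≤ (2 : ℝ) ^ (-(n : ℤ)) := by
    intro n x
    rw [Multiplicative.mem_toSubgroup, AddMonoidHom.mem_ker, RingHom.toAddMonoidHom_eq_coe,
      AddMonoidHom.coe_coe, ← RingHom.mem_ker, PadicInt.ker_toZModPow, Nat.cast_ofNat]
    have e := PadicInt.norm_le_pow_iff_mem_span_pow (p := 2) (Multiplicative.toAdd x) n
    simp only [Nat.cast_ofNat] at e
    exact e.symm
  have hidx : ∀ n : ℕ, ((PadicInt.toZModPow (p := 2) n).toAddMonoidHom.ker.toSubgroup).index = 2 ^ n := by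
    intro n
    rw [AddSubgroup.index_toSubgroup, AddSubgroup.index_ker,
      AddMonoidHom.range_eq_top.mpr (hsurj n), AddSubgroup.card_top, Nat.card_zmod]
  let L : LevelFamily (Multiplicative ℤ_[2]) :=
    { N := fun n => (PadicInt.toZModPow (p := 2) n).toAddMonoidHom.ker.toSubgroup
      normal := fun n => inferInstance
      isOpen := fun n => by
        have hset : ((PadicInt.toZModPow (p := 2) n).toAddMonoidHom.ker.toSubgroup :
            Set (Multiplicative ℤ_[2])) =
            Multiplicative.toAdd ⁻¹' Metric.closedBall (0 : ℤ_[2]) ((2 : ℝ) ^ (-(n : ℤ))) := by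
          ext x
          rw [SetLike.mem_coe, hmem, Set.mem_preimage, Metric.mem_closedBall, dist_zero_right]
        rw [hset]
        exact (IsUltrametricDist.isOpen_closedBall _ (by positivity)).preimage continuous_toAdd
      finiteQuotient := fun n => Subgroup.index_ne_zero_iff_finite.mp (by rw [hidx]; positivity)
      basis := fun U hU h1 => by
        have hU' : IsOpen (Multiplicative.ofAdd ⁻¹' U) := hU.preimage continuous_ofAdd
        obtain ⟨ε, hε, hball⟩ := Metric.isOpen_iff.mp hU' 0 h1
        obtain ⟨n, hn⟩ := exists_pow_lt_of_lt_one hε (by norm_num : (1 / 2 : ℝ) < 1)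
        refine ⟨n, fun x hx => ?_⟩
        have hx' : ‖Multiplicative.toAdd x‖ < ε := by
          refine lt_of_le_of_lt ((hmem n x).mp hx) (lt_of_le_of_lt (le_of_eq ?_) hn)
          rw [zpow_neg, zpow_natCast, one_div, inv_pow]
        have := hball (by rwa [Metric.mem_ball, dist_zero_right])
        rwa [Set.mem_preimage, ofAdd_toAdd] at this
      unbounded := fun M => ⟨M, by
        rw [← Subgroup.index_eq_card, hidx]
        exact Nat.lt_two_pow_self.le⟩ }
  obtain ⟨ψ, -, hψ⟩ := h (OneVertex.graph (Multiplicative ℤ_[2])) (OneVertex.chart L) PUnit.unit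
  -- `π₁^temp = ℤ₂` is abelian: every centraliser is everything
  have hbot := hψ.centralizer_eq_bot ⊤ isOpen_univ
  have htop : Subgroup.centralizer
      ((((⊤ : Subgroup (Multiplicative ℤ_[2])).map ψ.toMonoidHom : Subgroup (Multiplicative ℤ_[2])) :
        Set (Multiplicative ℤ_[2]))) = ⊤ :=
    Subgroup.centralizer_eq_top_iff_subset.mpr (by
      rw [CommGroup.center_eq_top]
      exact fun _ _ => trivial)
  have key : (⊤ : Subgroup (Multiplicative ℤ_[2])) = ⊥ := htop.symm.trans hbot
  have h1 : Multiplicative.ofAdd (1 : ℤ_[2]) ∈ (⊥ : Subgroup (Multiplicative ℤ_[2])) :=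
    key ▸ Subgroup.mem_top _
  rw [Subgroup.mem_bot, ofAdd_eq_one] at h1
  exact one_ne_zero h1

end Literature.AnabelianGeometry.SemiGraphs.ProfiniteSemiGraph

end
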